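import Literature.NumberTheory.LFunctions.NymanBeurlingProofs
import Mathlib.Analysis.SpecialFunctions.ImproperIntegrals
import Mathlib.LinearAlgebra.Matrix.PosDef
import Summits.RiemannHypothesis.RiemannHypothesis.Theorems.NymanBeurlingTailLeaf
import HarnessLib

/-!
# RiemannHypothesis / Nyman–Beurling — the HEAD/TAIL (Sherman–Morrison) structure of the Báez-Duarte minimiser (RH-FREE per N)

Theory memo `theory/TARGETS.md` §8.2 (T2), cell `pub/rh-li`: the Gram matrix on `(0,∞)` is the Gram matrix on Nyman's
interval `(0,1)` plus a rank-one tail, `G_{jk} = G⁰_{jk} + w_j w_k`, `w_k = 1/(k+1)` (`nbGramSplit`), hence for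
`G c⋆ = b`, `G⁰ c⁰ = b`, `G⁰ u = w`, `s = Σ u_k w_k ≥ 0`:
`tailConst(c⋆)·(1 + s) = tailConst(c⁰)` and `1 − b·c⋆ = (1 − b·c⁰) + tailConst(c⁰)²/(1 + s)` (`nbHeadTailIdentity`):
Báez-Duarte's distance = the Nyman-interval distance + a rank-one tail price.  RH-FREE [rh-li-prover]: finite-`N` linear
algebra; nothing here bears on the truth of RH.
-/

noncomputable section

-- D-0017: `Summit.<S>.<S>.…` is the designed namespace of a single-problem summit.
set_option linter.dupNamespace false

open MeasureTheory Set Finset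

namespace Summit.RiemannHypothesis.RiemannHypothesis.Theorems.NbTheory

open Literature.NumberTheory.LFunctions Literature.NumberTheory.LFunctions.BaezDuarteOnlyIf

namespace HeadTail

/-- On `x > 1`: `ρ_{j+1}(x) ρ_{k+1}(x) = x⁻²/((j+1)(k+1))`. -/
lemma nbRho_mul_nbRho_eq_of_one_lt (j k : ℕ) {x : ℝ} (hx : 1 < x) :
    nbRho j x * nbRho k x = 1 / (((j : ℝ) + 1) * ((k : ℝ) + 1)) * x ^ (-2 : ℝ) := by
  have hx0 : 0 < x := zero_lt_one.trans hx
  rw [nbRho_eq_of_one_lt j hx, nbRho_eq_of_one_lt k hx, Real.rpow_neg hx0.le, Real.rpow_two]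
  field_simp

/-- `ρ_{j+1} ρ_{k+1}` is integrable on `(1,∞)`. -/
lemma integrableOn_nbRho_mul_nbRho_Ioi (j k : ℕ) :
    IntegrableOn (fun x ↦ nbRho j x * nbRho k x) (Set.Ioi (1 : ℝ)) := by
  have h : IntegrableOn (fun x : ℝ ↦ 1 / (((j : ℝ) + 1) * ((k : ℝ) + 1)) * x ^ (-2 : ℝ)) (Set.Ioi (1 : ℝ)) :=
    (integrableOn_Ioi_rpow_of_lt (by norm_num : (-2 : ℝ) < -1) zero_lt_one).const_mul _
  exact h.congr_fun (fun x hx ↦ (nbRho_mul_nbRho_eq_of_one_lt j k hx).symm) measurableSet_Ioi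

/-- `∫_1^∞ ρ_{j+1} ρ_{k+1} = 1/((j+1)(k+1))`. -/
lemma integral_Ioi_nbRho_mul_nbRho (j k : ℕ) :
    ∫ x in Set.Ioi (1 : ℝ), nbRho j x * nbRho k x = 1 / (((j : ℝ) + 1) * ((k : ℝ) + 1)) := by
  rw [setIntegral_congr_fun measurableSet_Ioi (fun x hx ↦ nbRho_mul_nbRho_eq_of_one_lt j k hx),
    integral_const_mul, integral_Ioi_rpow_of_lt (by norm_num) zero_lt_one]
  norm_num [Real.one_rpow]

end HeadTail

open HeadTail

/-- **(T2a) `NbGramSplit` (RH-FREE): `G_{jk} = G⁰_{jk} + 1/((j+1)(k+1))`** — on `x > 1` both fractional parts are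
`1/((·+1)x)` and `∫_1^∞ x⁻² = 1`. -/
theorem nbGramSplit (j k : ℕ) : nbGram j k = nbGram0 j k + 1 / (((j : ℝ) + 1) * ((k : ℝ) + 1)) := by
  unfold nbGram nbGram0
  rw [← Set.Ioc_union_Ioi_eq_Ioi zero_le_one,
    setIntegral_union Set.Ioc_disjoint_Ioi_same measurableSet_Ioi (integrableOn_nbRho_mul_nbRho_Ioc j k)
      (HeadTail.integrableOn_nbRho_mul_nbRho_Ioi j k),
    HeadTail.integral_Ioi_nbRho_mul_nbRho]

/-- `G⁰` is symmetric. -/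
theorem nbGram0_comm (j k : ℕ) : nbGram0 j k = nbGram0 k j := by
  unfold nbGram0; congr 1; funext x; ring

/-- **(T2b) `NbHeadTailIdentity` (RH-FREE per N; Sherman–Morrison for the rank-one tail).**  If `G c = b`,
`G⁰ c⁰ = b`, `G⁰ u = w` (`w_k = 1/(k+1)`) with `G⁰` positive definite, and `s = Σ_k u_k/(k+1)`, then
`tailConst(c)·(1 + s) = tailConst(c⁰)` and `1 − b·c = (1 − b·c⁰) + tailConst(c⁰)²/(1 + s)`. -/
theorem nbHeadTailIdentity (N : ℕ) (cs c0 u : Fin N → ℝ) (hPD : (nbGram0Matrix N).PosDef)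
    (hG : ∀ k : Fin N, ∑ j : Fin N, nbGram k j * cs j = nbRhs k)
    (hG0 : ∀ k : Fin N, ∑ j : Fin N, nbGram0 k j * c0 j = nbRhs k)
    (hu : ∀ k : Fin N, ∑ j : Fin N, nbGram0 k j * u j = 1 / ((k : ℝ) + 1)) :
    tailConst cs * (1 + ∑ k : Fin N, u k / ((k : ℝ) + 1)) = tailConst c0 ∧
      1 - ∑ k : Fin N, cs k * nbRhs k =
        (1 - ∑ k : Fin N, c0 k * nbRhs k) + tailConst c0 ^ 2 / (1 + ∑ k : Fin N, u k / ((k : ℝ) + 1)) := by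
  classical
  set τ : ℝ := tailConst cs with hτ
  set τ0 : ℝ := tailConst c0 with hτ0
  set s : ℝ := ∑ k : Fin N, u k / ((k : ℝ) + 1) with hs
  have hτdef : τ = ∑ j : Fin N, cs j / ((j : ℕ) + 1 : ℝ) := by rw [hτ, tailConst]
  have hτ0def : τ0 = ∑ j : Fin N, c0 j / ((j : ℕ) + 1 : ℝ) := by rw [hτ0, tailConst]
  -- (1) the normal equations of `G` read through the split: `G⁰ c = b − τ w = G⁰ (c⁰ − τ u)`
  have hrow : ∀ k : Fin N, ∑ j : Fin N, nbGram0 k j * cs j = ∑ j : Fin N, nbGram0 k j * (c0 j - τ * u j) := by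
    intro k
    have h1 := hG k
    have hsplit : ∑ j : Fin N, nbGram k j * cs j =
        ∑ j : Fin N, nbGram0 k j * cs j + 1 / ((k : ℝ) + 1) * τ := by
      rw [hτdef, Finset.mul_sum, ← Finset.sum_add_distrib]
      refine Finset.sum_congr rfl fun j _ ↦ ?_
      rw [nbGramSplit, one_div (((k : ℕ) + 1 : ℝ) * ((j : ℕ) + 1)), mul_inv]
      ring
    have h2 : ∑ j : Fin N, nbGram0 k j * (c0 j - τ * u j) =
        ∑ j : Fin N, nbGram0 k j * c0 j - τ * ∑ j : Fin N, nbGram0 k j * u j := by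
      rw [Finset.mul_sum, ← Finset.sum_sub_distrib]
      refine Finset.sum_congr rfl fun j _ ↦ by ring
    rw [h2, hG0 k, hu k]
    linarith
  -- (2) injectivity of `G⁰` (positive definite ⇒ `mulVec` injective): `c = c⁰ − τ u`
  have hmv : ∀ v : Fin N → ℝ, ∀ k, (nbGram0Matrix N).mulVec v k = ∑ j : Fin N, nbGram0 k j * v j := by
    intro v k; simp [Matrix.mulVec, dotProduct, nbGram0Matrix]
  have hinj : Function.Injective (nbGram0Matrix N).mulVec :=
    Matrix.mulVec_injective_iff_isUnit.2 hPD.isUnit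
  have hcs : cs = fun j ↦ c0 j - τ * u j := by
    apply hinj
    funext k
    rw [hmv, hmv, hrow k]
  -- (3) `τ (1 + s) = τ0`
  have hτs : τ * (1 + s) = τ0 := by
    have e1 : τ = ∑ j : Fin N, (c0 j - τ * u j) / ((j : ℕ) + 1 : ℝ) := by
      conv_lhs => rw [hτdef]
      exact Finset.sum_congr rfl fun j _ ↦ by simp only [hcs]
    have e2 : ∑ j : Fin N, (c0 j - τ * u j) / ((j : ℕ) + 1 : ℝ) = τ0 - τ * s := by
      rw [hτ0def, hs, Finset.mul_sum, ← Finset.sum_sub_distrib]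
      exact Finset.sum_congr rfl fun j _ ↦ by ring
    linarith
  -- (4) `b·u = τ0` by the symmetry of `G⁰`
  have hbu : ∑ k : Fin N, u k * nbRhs k = τ0 := by
    calc ∑ k : Fin N, u k * nbRhs k = ∑ k : Fin N, u k * ∑ j : Fin N, nbGram0 k j * c0 j := by
          refine Finset.sum_congr rfl fun k _ ↦ by rw [hG0 k]
      _ = ∑ j : Fin N, c0 j * ∑ k : Fin N, nbGram0 j k * u k := by
          simp_rw [Finset.mul_sum]
          rw [Finset.sum_comm]
          refine Finset.sum_congr rfl fun j _ ↦ Finset.sum_congr rfl fun k _ ↦ ?_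
          rw [nbGram0_comm k j]; ring
      _ = ∑ j : Fin N, c0 j * (1 / ((j : ℝ) + 1)) := by
          refine Finset.sum_congr rfl fun j _ ↦ by rw [hu j]
      _ = τ0 := by rw [hτ0def]; refine Finset.sum_congr rfl fun j _ ↦ by ring
  -- (5) `s ≥ 0` (`s = uᵀ G⁰ u`)
  have hs0 : 0 ≤ s := by
    have hq : s = ∑ k : Fin N, u k * ∑ j : Fin N, nbGram0 k j * u j := by
      rw [hs]; refine Finset.sum_congr rfl fun k _ ↦ by rw [hu k]; ring
    have hform : (star u) ⬝ᵥ (nbGram0Matrix N).mulVec u = s := by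
      rw [hq, dotProduct]
      refine Finset.sum_congr rfl fun k _ ↦ ?_
      rw [hmv]; simp
    rw [← hform]
    exact hPD.posSemidef.dotProduct_mulVec_nonneg u
  refine ⟨hτs, ?_⟩
  -- (6) the distance identity
  have h1s : 1 + s ≠ 0 := by linarith
  have hbc : ∑ k : Fin N, cs k * nbRhs k = ∑ k : Fin N, c0 k * nbRhs k - τ * τ0 := by
    rw [← hbu, Finset.mul_sum, ← Finset.sum_sub_distrib]
    refine Finset.sum_congr rfl fun k _ ↦ ?_
    simp only [hcs]; ring
  have hτeq : τ = τ0 / (1 + s) := by rw [eq_div_iff h1s]; exact hτs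
  rw [hbc, hτeq]
  field_simp
  ring

end Summit.RiemannHypothesis.RiemannHypothesis.Theorems.NbTheory

end
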